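import Summits.BirchSwinnertonDyer.BirchSwinnertonDyer.Theorems.PrintCf2SplitBadTwoLocSurjSignTwist
import HarnessLib

/-!
# Crux `PrintCf2.SplitBadTwoRankOneOfFacts` (stmt-BirchSwinnertonDyer-20368), skeleton v13.5, (REG₂) `stub_xRegular_two` FACT-FREE road, R2 brick
# **(LSₙ) for `A_θ` from (LSₙ) for ANY `εχ`-twisted model** — the glue of case (B2) of «B5-T»

Cell `bsd-print-cf2`, EXTRA WIDTH seat `bsd-line-cf2-p1-w4` g14 (prover-bsd-line-cf2-p1-w4-g14-0); `--supports stmt-BirchSwinnertonDyer-20368`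
(helper, Theses-free). HONEST FRAMING: nothing here closes the crux or a registered stub; BSD is not proved by any of this; no summit
statement is proved by this seat. No definition, no named fact, no `sorry`.

WHY (STATUS 2026-08-29T09:2xZ, case plan (a)/(b)/(c) for the (REG₂)/24246 closer). In case (c) = (B2) the closer runs -w8 g5's
`LayerShapiro.locSurj_layers_twisted` on an abstract discrete module `A′ ≃+ ℚ₂/ℤ₂` carrying the RE-TWISTED sign `εχ` (`χ` from
`SignTwist.exists_signHom_retwist`, trivial on the layer group `U`, `εχ = 1` on `D_v̄`) and must come back to `A_θ = charModule ∅ θ`, on which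
`Γ_K` acts through `ε` (p706294). This file is that one step, for ANY such model:
* **`locSurj_charModule_of_twistedModel`** — `θ` quadratic with sign reading `σ • a = ε(σ) • a` on `A_θ`; `A′` any discrete `Γ_K`-module with
  `σ • a′ = (εχ)(σ) • a′` and an additive isomorphism `e′ : A_θ ≃+ A′`; `χ|_U = 1` ⟹ `(LSₙ)(U, A′, P) ⟹ (LSₙ)(U, A_θ, P)`
  (`SignTwist.locSurj_of_signEquiv` for `e′⁻¹`, whose sign law is `e′⁻¹(σ • a′) = χ(σ) • σ • e′⁻¹ a′`);
* `smul_symm_eq` — that sign law.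
presearch: none needed (bookkeeping over p708344). beyond-print theorem: no.

References: [GreenbergLNM1716] §4 p. 107; [SerreGaloisCohomology1997] I §2.5.
-/

noncomputable section

open scoped Classical

set_option linter.dupNamespace false
set_option autoImplicit false

open NumberField IsDedekindDomain Field
open Literature.NumberTheory.EllipticCurves Literature.NumberTheory.EllipticCurves.GreenbergSelmer
open Literature.NumberTheory.EllipticCurves.GreenbergVatsal2000 Literature.NumberTheory.EllipticCurves.KellerYin2024
open Literature.NumberTheory.GaloisRepresentations Literature.NumberTheory.IwasawaTheory

namespace Summit.BirchSwinnertonDyer.BirchSwinnertonDyer.Theorems.PrintCf2.SignTwist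

variable {K : Type} [Field K] [NumberField K]
  {A' : Type} [AddCommGroup A'] [DistribMulAction (absoluteGaloisGroup K) A'] [TopologicalSpace A'] [DiscreteTopology A']
  (θ : FramedGaloisRep K (padicCoeffIntegers (∅ : Set (PadicAlgCl 2))) 1) (ε χ : absoluteGaloisGroup K →* ℤˣ)
  (hεθ : ∀ (σ : absoluteGaloisGroup K) (a : charModule (∅ : Set (PadicAlgCl 2)) θ), σ • a = ((ε σ : ℤˣ) : ℤ) • a)
  (hA' : ∀ (σ : absoluteGaloisGroup K) (a' : A'), σ • a' = (((ε * χ) σ : ℤˣ) : ℤ) • a')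
  (e' : charModule (∅ : Set (PadicAlgCl 2)) θ ≃+ A')

omit [NumberField K] [TopologicalSpace A'] [DiscreteTopology A'] in
include hεθ hA' in
/-- The sign law of `e′⁻¹ : A′ → A_θ` for an `εχ`-twisted model `A′` of the `ε`-module `A_θ`: `e′⁻¹ (σ • a′) = χ(σ) • σ • e′⁻¹ a′`.
[folklore] -/
theorem smul_symm_eq (σ : absoluteGaloisGroup K) (a' : A') :
    e'.symm (σ • a') = ((χ σ : ℤˣ) : ℤ) • σ • e'.symm a' := by
  rw [hA', _root_.map_zsmul, hεθ, MonoidHom.mul_apply, Units.val_mul, mul_comm, mul_zsmul]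

include e' hεθ hA' in
/-- **(LSₙ) for `A_θ` from (LSₙ) for any `εχ`-twisted model `A′ ≃+ A_θ`, `χ|_U = 1`.** For `U ≤ Γ_K` normal, a quadratic framed `θ` whose
module `A_θ` is read through the sign `ε` (`σ • a = ε(σ) • a`, p706294 `exists_signHom_of_sq_eq_one`), a sign `χ` trivial on `U`, and ANY
discrete `Γ_K`-module `A′` with `σ • a′ = (εχ)(σ) • a′` and an additive isomorphism `e′ : A_θ ≃+ A′`: local surjectivity modulo unramified
classes over `U` (the `hLSn` body, VERBATIM, any place predicate `P`) for `A′` implies it for `A_θ`. Use: case (B2) of the twisted `v̄`-reading —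
`A′ = ℚ₂/ℤ₂` with the `εχ`-action of `SignTwist.exists_signHom_retwist`, fed to -w8 g5's `LayerShapiro.locSurj_layers_twisted`.
[cite: GreenbergLNM1716, §4 p. 107] [cite: SerreGaloisCohomology1997, I §2.5] -/
theorem locSurj_charModule_of_twistedModel (U : Subgroup (absoluteGaloisGroup K)) [U.Normal] (hχU : ∀ u ∈ U, χ u = 1)
    (P : HeightOneSpectrum (𝓞 K) → Prop)
    (hLS : ∀ (T : Finset (HeightOneSpectrum (𝓞 K))), (∀ w ∈ T, P w) →
      ∀ τ : (w : HeightOneSpectrum (𝓞 K)) →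
        DoubleCoset.Quotient (decomp (K := K) w : Set (absoluteGaloisGroup K)) (U : Set (absoluteGaloisGroup K)) → subgroupH1 (decompIn U w) A',
      ∃ z : subgroupH1 U A',
        (∀ w ∈ T, ∀ Q : DoubleCoset.Quotient (decomp (K := K) w : Set (absoluteGaloisGroup K)) (U : Set (absoluteGaloisGroup K)),
          resOfLe A' (inertiaIn_le_decompIn U w)
            (resH1Hom (decompInToH U w) (AddMonoidHom.id A') (fun _ _ ↦ rfl) (conjH1 U A' Q.out z) - τ w Q) = 0) ∧
        (∀ w : HeightOneSpectrum (𝓞 K), w ∉ T → P w → ∀ σ : absoluteGaloisGroup K, conjH1 U A' σ z ∈ unramifiedKer U A' w)) :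
    ∀ (T : Finset (HeightOneSpectrum (𝓞 K))), (∀ w ∈ T, P w) →
      ∀ τ' : (w : HeightOneSpectrum (𝓞 K)) →
        DoubleCoset.Quotient (decomp (K := K) w : Set (absoluteGaloisGroup K)) (U : Set (absoluteGaloisGroup K)) →
          subgroupH1 (decompIn U w) (charModule (∅ : Set (PadicAlgCl 2)) θ),
      ∃ z' : subgroupH1 U (charModule (∅ : Set (PadicAlgCl 2)) θ),
        (∀ w ∈ T, ∀ Q : DoubleCoset.Quotient (decomp (K := K) w : Set (absoluteGaloisGroup K)) (U : Set (absoluteGaloisGroup K)),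
          resOfLe (charModule (∅ : Set (PadicAlgCl 2)) θ) (inertiaIn_le_decompIn U w)
            (resH1Hom (decompInToH U w) (AddMonoidHom.id (charModule (∅ : Set (PadicAlgCl 2)) θ)) (fun _ _ ↦ rfl)
              (conjH1 U (charModule (∅ : Set (PadicAlgCl 2)) θ) Q.out z') - τ' w Q) = 0) ∧
        (∀ w : HeightOneSpectrum (𝓞 K), w ∉ T → P w →
          ∀ σ : absoluteGaloisGroup K, conjH1 U (charModule (∅ : Set (PadicAlgCl 2)) θ) σ z' ∈
            unramifiedKer U (charModule (∅ : Set (PadicAlgCl 2)) θ) w) :=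
  locSurj_of_signEquiv χ e'.symm U hχU (smul_symm_eq θ ε χ hεθ hA' e') P hLS

end Summit.BirchSwinnertonDyer.BirchSwinnertonDyer.Theorems.PrintCf2.SignTwist

end
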